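import Summits.Ventures.DiscreteObjects.UnitDistance.Sqrt2Sqrt3Plane

/-!
# Four colours for every multiquadratic field inside `ℚ₂(√2, √3)` (cell `pub-namedobj`, target (U), seat udg g10)

Framing (verbatim for the cell): lottery ticket; floor = certified bounds/negative ranges.

Unifies U1/U4/`MoserMultiquadratic`: let `S ⊂ ℕ` be finite with every `d ∈ S` satisfying `d ≡ 1, 3 (mod 8)` or
`d ≡ 2, 6 (mod 16)` (i.e. `d = m` or `d = 2m` with `m ≡ 1, 3 (mod 8)`; equivalently the 2-adic square class of `d` lies in
`⟨[2], [3]⟩ = {1, [2], [3], [6]}`, which avoids `[−1]` — Prop U2 of the cell).  Then the real field `ℚ(√d : d ∈ S)` embeds into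
`ℚ₂(√2, √3) ⊂ \overline{ℚ₂}` and every unit-distance graph with coordinates in it is `4`-colourable
(`colorable_four_of_multiSqrtField₂₃`).  Examples: `ℚ(√2,√3)` (U4), `ℚ(√3,√11)` (U1), `ℚ(√2,√3,√6,√11,√17,√19,√22,√34,√38)`.
Nothing here is literature.
-/

noncomputable section

namespace Summit.Ventures.DiscreteObjects.UnitDistance

open MoserLocal SimpleGraph IntermediateField
open scoped IntermediateField

/-- Square roots inside `ℚ₂(s2, s3)`: if `d ≡ 1, 3 (mod 8)` or `d ≡ 2, 6 (mod 16)` then some `w ∈ ℚ₂(s2, s3)` has `w² = d`. -/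
theorem exists_sq_eq_in_adjoin_sqrt2_sqrt3 (D : LocalData23 Ω₂) (d : ℕ)
    (hd : d % 8 = 1 ∨ d % 8 = 3 ∨ d % 16 = 2 ∨ d % 16 = 6) :
    ∃ w ∈ ℚ_[2]⟮D.s2, D.s3⟯, w ^ 2 = (d : Ω₂) := by
  have m2 : D.s2 ∈ ℚ_[2]⟮D.s2, D.s3⟯ := subset_adjoin _ _ (by simp)
  have m3 : D.s3 ∈ ℚ_[2]⟮D.s2, D.s3⟯ := subset_adjoin _ _ (by simp)
  have hs3ne : D.s3 ≠ 0 := by intro h0; have := D.hs3; rw [h0] at this; norm_num at this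
  -- odd part `m` with `m % 8 ∈ {1, 3}` and `d = m` or `d = 2 m`
  have key : ∀ m : ℕ, (m % 8 = 1 ∨ m % 8 = 3) → ∃ w ∈ ℚ_[2]⟮D.s2, D.s3⟯, w ^ 2 = (m : Ω₂) := by
    intro m hm
    rcases hm with h1 | h3
    · obtain ⟨r, hr⟩ := TwoAdic.exists_sq_eq_of_mod_eight_eq_one m h1
      refine ⟨algebraMap ℚ_[2] Ω₂ r, IntermediateField.algebraMap_mem _ _, ?_⟩
      rw [← map_pow, hr, map_natCast]
    · have h3d : (3 * m) % 8 = 1 := by omega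
      obtain ⟨r, hr⟩ := TwoAdic.exists_sq_eq_of_mod_eight_eq_one (3 * m) h3d
      refine ⟨algebraMap ℚ_[2] Ω₂ r * D.s3⁻¹, mul_mem (IntermediateField.algebraMap_mem _ _) (inv_mem m3), ?_⟩
      rw [mul_pow, ← map_pow, hr, inv_pow, D.hs3]
      simp only [Nat.cast_mul, Nat.cast_ofNat, map_mul, map_natCast, map_ofNat]
      field_simp
  rcases hd with h1 | h3 | h2 | h6
  · exact key d (Or.inl h1)
  · exact key d (Or.inr h3)
  · obtain ⟨w, hw, hw2⟩ := key (d / 2) (by omega)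
    refine ⟨D.s2 * w, mul_mem m2 hw, ?_⟩
    have hd2 : d = 2 * (d / 2) := by omega
    rw [mul_pow, hw2, D.hs2]
    conv_rhs => rw [hd2]
    push_cast; ring
  · obtain ⟨w, hw, hw2⟩ := key (d / 2) (by omega)
    refine ⟨D.s2 * w, mul_mem m2 hw, ?_⟩
    have hd2 : d = 2 * (d / 2) := by omega
    rw [mul_pow, hw2, D.hs2]
    conv_rhs => rw [hd2]
    push_cast; ring

/-- IMAGE LEMMA: under the hypothesis on `S`, the embedding of `ℚ(√d : d ∈ S)` lands in `ℚ₂(s2, s3)`. -/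
theorem multiSqrtEmbed_mem₂₃ (S : Finset ℕ) (hS : ∀ d ∈ S, d % 8 = 1 ∨ d % 8 = 3 ∨ d % 16 = 2 ∨ d % 16 = 6)
    (D : LocalData23 Ω₂) (t : multiSqrtField S) : multiSqrtEmbed S t ∈ ℚ_[2]⟮D.s2, D.s3⟯ := by
  obtain ⟨t, ht⟩ := t
  induction ht using IntermediateField.adjoin_induction with
  | mem y hy =>
    obtain ⟨d, hdS, rfl⟩ := hy
    have hdS' : d ∈ S := by simpa using hdS
    have hmem : Real.sqrt d ∈ multiSqrtField S := IntermediateField.subset_adjoin ℚ _ ⟨d, hdS, rfl⟩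
    have hsq : (multiSqrtEmbed S ⟨Real.sqrt d, hmem⟩) ^ 2 = (d : Ω₂) := by
      have hK : (⟨Real.sqrt d, hmem⟩ : multiSqrtField S) ^ 2 = d := by
        apply Subtype.ext
        simp [Real.sq_sqrt (Nat.cast_nonneg d)]
      rw [← map_pow, hK, map_natCast]
    obtain ⟨w, hw, hw2⟩ := exists_sq_eq_in_adjoin_sqrt2_sqrt3 D d (hS d hdS')
    have h : (multiSqrtEmbed S ⟨Real.sqrt d, hmem⟩) ^ 2 = w ^ 2 := by rw [hsq, hw2]
    rcases sq_eq_sq_iff_eq_or_eq_neg.1 h with h' | h'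
    · rw [h']; exact hw
    · rw [h']; exact neg_mem hw
  | algebraMap q =>
    have : (⟨algebraMap ℚ ℝ q, IntermediateField.algebraMap_mem _ q⟩ : multiSqrtField S) =
        algebraMap ℚ (multiSqrtField S) q := Subtype.ext rfl
    rw [this, (multiSqrtEmbed S).commutes, algebraMap_rat_eq]
    exact IntermediateField.algebraMap_mem _ _
  | add y w hy hw ihy ihw =>
    have : (⟨y + w, add_mem hy hw⟩ : multiSqrtField S) = ⟨y, hy⟩ + ⟨w, hw⟩ := rfl
    rw [this, map_add]; exact add_mem ihy ihw
  | inv y hy ihy =>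
    have : (⟨y⁻¹, inv_mem hy⟩ : multiSqrtField S) = ⟨y, hy⟩⁻¹ := rfl
    rw [this, map_inv₀]; exact inv_mem ihy
  | mul y w hy hw ihy ihw =>
    have : (⟨y * w, mul_mem hy hw⟩ : multiSqrtField S) = ⟨y, hy⟩ * ⟨w, hw⟩ := rfl
    rw [this, map_mul]; exact mul_mem ihy ihw

/-- THEOREM (Prop U2 for the square classes `⟨[2],[3]⟩`, kernel): if every `d ∈ S` is `≡ 1, 3 (mod 8)` or `≡ 2, 6 (mod 16)`,
every graph with `ℚ(√d : d ∈ S)`-coordinates and unit-quadrance edges is `4`-colourable. -/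
theorem colorable_four_of_multiSqrtField₂₃ (S : Finset ℕ)
    (hS : ∀ d ∈ S, d % 8 = 1 ∨ d % 8 = 3 ∨ d % 16 = 2 ∨ d % 16 = 6)
    {V : Type*} {G : SimpleGraph V} (x y : V → multiSqrtField S)
    (hadj : ∀ ⦃v w : V⦄, G.Adj v w → (x v - x w) ^ 2 + (y v - y w) ^ 2 = 1) : G.Colorable 4 := by
  set D := localData23 with hD
  set φ : multiSqrtField S →ₐ[ℚ] Ω₂ := multiSqrtEmbed S with hφ
  let z : V → Ω₂ := fun v => φ (x v) + D.I * φ (y v)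
  apply colorable_four_of_unitStep23_labels D z
  intro v w hvw
  obtain ⟨a, b, c, d, hX⟩ := exists_coeffs_of_mem_adjoin_sqrt2_sqrt3 D (multiSqrtEmbed_mem₂₃ S hS D (x v - x w))
  obtain ⟨e, f, g, h, hY⟩ := exists_coeffs_of_mem_adjoin_sqrt2_sqrt3 D (multiSqrtEmbed_mem₂₃ S hS D (y v - y w))
  refine ⟨a, b, c, d, e, f, g, h, ?_, ?_⟩
  · change (φ (x v) + D.I * φ (y v)) - (φ (x w) + D.I * φ (y w)) = _
    rw [← hX, ← hY, map_sub, map_sub]; ring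
  · rw [← hX, ← hY, ← map_pow, ← map_pow, ← map_add, hadj hvw, map_one]

/-- Realisation form: all coordinates in `ℚ(√d : d ∈ S)` with `S` as above ⇒ `4`-colourable.  E.g. no 5-chromatic
unit-distance graph lives in `ℚ(√2, √3, √6, √11, √17, √19, √22)²`. -/
theorem colorable_four_of_realisation_in_multiSqrtField₂₃ (S : Finset ℕ)
    (hS : ∀ d ∈ S, d % 8 = 1 ∨ d % 8 = 3 ∨ d % 16 = 2 ∨ d % 16 = 6)
    {V : Type*} {G : SimpleGraph V} {p : V → EuclideanSpace ℝ (Fin 2)} (hp : IsUnitDistanceRealisation G p)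
    (hK : ∀ v i, p v i ∈ multiSqrtField S) : G.Colorable 4 := by
  refine colorable_four_of_multiSqrtField₂₃ S hS (G := G) (fun v => ⟨p v 0, hK v 0⟩) (fun v => ⟨p v 1, hK v 1⟩) ?_
  intro v w hvw
  apply Subtype.ext
  push_cast
  exact sq_add_sq_eq_one_of_dist_eq_one (hp.2 hvw)

/-- The unit-quadrance graph of `ℚ(√d : d ∈ S)` is `4`-colourable for such `S`. -/
theorem colorable_four_unitCircleGraph_multiSqrtField₂₃ (S : Finset ℕ)
    (hS : ∀ d ∈ S, d % 8 = 1 ∨ d % 8 = 3 ∨ d % 16 = 2 ∨ d % 16 = 6) :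
    (unitCircleGraph (multiSqrtField S)).Colorable 4 :=
  colorable_four_of_multiSqrtField₂₃ S hS (G := unitCircleGraph (multiSqrtField S)) Prod.fst Prod.snd fun _ _ h => h.2

/-- Example: `χ(ℚ(√2, √3, √6, √11, √17, √19, √22)²) ≤ 4`. -/
example : (unitCircleGraph (multiSqrtField {2, 3, 6, 11, 17, 19, 22})).Colorable 4 :=
  colorable_four_unitCircleGraph_multiSqrtField₂₃ _ (by decide)

end Summit.Ventures.DiscreteObjects.UnitDistance
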